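import Mathlib

/-!
# Comb lemma, layer 1: cone-field dynamics on a tube

Elementary iterative estimates for a map `T : E × ℝ → E × ℝ` (`E` a real normed group, the
"stable" directions; `ℝ` the unstable one) on the tube `‖x‖ ≤ ρ`, under the three hypotheses of the
corrected comb lemma (line `heteroclinic_comb` of crux `LaminatedThreshold`, adapted coordinates):

* (H1) `x`-contraction `‖(T p).1‖ ≤ λ ‖p.1‖`, `0 ≤ λ ≤ 1`;
* (H2) invariance and expansion (`μ`) of the vertical cone `‖Δx‖ ≤ κ Δt` for pairs in the tube;
* (H3) the axis defect `|(T (x, 0)).2| ≤ δ ‖x‖` with `λ ≤ μ - δ`, `1 < μ - δ`.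

Consequences: iterates stay in the tube; an orbit strictly above the noise level (`‖x‖ < t`)
climbs geometrically and stays above it; two points on a vertical line separate geometrically
while staying in the cone; the mirror map `(x, t) ↦ (T(x, -t)).1, -(T(x, -t)).2)` satisfies the
same hypotheses.
-/

set_option linter.dupNamespace false

namespace Summit.FinalStateConjecture.FinalStateConjecture.Theorems.LaminatedThreshold.Comb

open Set Function

variable {E : Type*} [NormedAddCommGroup E]

/-- (H1) iterated: the `x`-component never grows, so orbits from the tube stay in the tube.
[folklore] -/
theorem iterate_fst_le {T : E × ℝ → E × ℝ} {ρ lam : ℝ} (_hlam0 : 0 ≤ lam) (hlam1 : lam ≤ 1)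
    (hx : ∀ p : E × ℝ, ‖p.1‖ ≤ ρ → ‖(T p).1‖ ≤ lam * ‖p.1‖)
    {p : E × ℝ} (hp : ‖p.1‖ ≤ ρ) (n : ℕ) : ‖(T^[n] p).1‖ ≤ ‖p.1‖ := by
  induction n with
  | zero => simp
  | succ n ih =>
    rw [iterate_succ_apply']
    calc ‖(T (T^[n] p)).1‖ ≤ lam * ‖(T^[n] p).1‖ := hx _ (ih.trans hp)
      _ ≤ 1 * ‖(T^[n] p).1‖ := by gcongr
      _ ≤ ‖p.1‖ := by rw [one_mul]; exact ih

/-- One step strictly above the noise level: the height is multiplied by at least `μ - δ` and the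
point stays strictly above the noise level. [folklore] -/
theorem step_above {T : E × ℝ → E × ℝ} {ρ lam μ κ δ : ℝ} (hlam0 : 0 ≤ lam) (hκ : 0 ≤ κ)
    (hδ : 0 ≤ δ) (hlamμ : lam < μ - δ)
    (hx : ∀ p : E × ℝ, ‖p.1‖ ≤ ρ → ‖(T p).1‖ ≤ lam * ‖p.1‖)
    (hcone : ∀ p q : E × ℝ, ‖p.1‖ ≤ ρ → ‖q.1‖ ≤ ρ → p.2 ≤ q.2 → ‖q.1 - p.1‖ ≤ κ * (q.2 - p.2) →
      μ * (q.2 - p.2) ≤ (T q).2 - (T p).2 ∧ ‖(T q).1 - (T p).1‖ ≤ κ * ((T q).2 - (T p).2))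
    (haxis : ∀ x : E, ‖x‖ ≤ ρ → |(T (x, 0)).2| ≤ δ * ‖x‖)
    {p : E × ℝ} (hp : ‖p.1‖ ≤ ρ) (habove : ‖p.1‖ < p.2) :
    (μ - δ) * p.2 ≤ (T p).2 ∧ ‖(T p).1‖ < (T p).2 := by
  have ht : 0 < p.2 := (norm_nonneg _).trans_lt habove
  have h1 := (hcone (p.1, 0) p hp hp ht.le (by simp; positivity)).1
  have h2 := haxis p.1 hp
  have h3 : δ * ‖p.1‖ ≤ δ * p.2 := by gcongr
  have h4 := (abs_le.1 (h2.trans h3)).1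
  have hT2 : (μ - δ) * p.2 ≤ (T p).2 := by
    simp only [sub_zero] at h1
    nlinarith
  refine ⟨hT2, ?_⟩
  calc ‖(T p).1‖ ≤ lam * ‖p.1‖ := hx p hp
    _ ≤ lam * p.2 := by gcongr
    _ < (μ - δ) * p.2 := by gcongr
    _ ≤ (T p).2 := hT2

/-- Iterated climb strictly above the noise level. [folklore] -/
theorem iterate_above {T : E × ℝ → E × ℝ} {ρ lam μ κ δ : ℝ} (hlam0 : 0 ≤ lam) (hlam1 : lam ≤ 1)
    (hκ : 0 ≤ κ) (hδ : 0 ≤ δ) (hlamμ : lam < μ - δ)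
    (hx : ∀ p : E × ℝ, ‖p.1‖ ≤ ρ → ‖(T p).1‖ ≤ lam * ‖p.1‖)
    (hcone : ∀ p q : E × ℝ, ‖p.1‖ ≤ ρ → ‖q.1‖ ≤ ρ → p.2 ≤ q.2 → ‖q.1 - p.1‖ ≤ κ * (q.2 - p.2) →
      μ * (q.2 - p.2) ≤ (T q).2 - (T p).2 ∧ ‖(T q).1 - (T p).1‖ ≤ κ * ((T q).2 - (T p).2))
    (haxis : ∀ x : E, ‖x‖ ≤ ρ → |(T (x, 0)).2| ≤ δ * ‖x‖)
    {p : E × ℝ} (hp : ‖p.1‖ ≤ ρ) (habove : ‖p.1‖ < p.2) (n : ℕ) :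
    (μ - δ) ^ n * p.2 ≤ (T^[n] p).2 ∧ ‖(T^[n] p).1‖ < (T^[n] p).2 := by
  induction n with
  | zero => simpa using habove
  | succ n ih =>
    have hpn : ‖(T^[n] p).1‖ ≤ ρ := (iterate_fst_le hlam0 hlam1 hx hp n).trans hp
    have hstep := step_above hlam0 hκ hδ hlamμ hx hcone haxis hpn ih.2
    rw [iterate_succ_apply']
    refine ⟨?_, hstep.2⟩
    have hμδ : 0 ≤ μ - δ := by linarith
    calc (μ - δ) ^ (n + 1) * p.2 = (μ - δ) * ((μ - δ) ^ n * p.2) := by ring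
      _ ≤ (μ - δ) * (T^[n] p).2 := by gcongr; exact ih.1
      _ ≤ (T (T^[n] p)).2 := hstep.1

/-- Two points on a vertical line of the tube separate at rate `μ` while their difference stays in
the vertical cone. [folklore] -/
theorem iterate_two_point : ∀ {E : Type*} [NormedAddCommGroup E] {T : E × ℝ → E × ℝ} {ρ lam μ κ : ℝ}, 0 ≤ lam → lam ≤ 1 → 0 ≤ κ → 0 ≤ μ → (∀ p : E × ℝ, ‖p.1‖ ≤ ρ → ‖(T p).1‖ ≤ lam * ‖p.1‖) → (∀ p q : E × ℝ, ‖p.1‖ ≤ ρ → ‖q.1‖ ≤ ρ → p.2 ≤ q.2 → ‖q.1 - p.1‖ ≤ κ * (q.2 - p.2) → μ * (q.2 - p.2) ≤ (T q).2 - (T p).2 ∧ ‖(T q).1 - (T p).1‖ ≤ κ * ((T q).2 - (T p).2)) → ∀ {p q : E × ℝ}, ‖p.1‖ ≤ ρ → q.1 = p.1 → p.2 ≤ q.2 → ∀ (n : ℕ), μ ^ n * (q.2 - p.2) ≤ (T^[n] q).2 - (T^[n] p).2 ∧ ‖(T^[n] q).1 - (T^[n] p).1‖ ≤ κ * ((T^[n]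 q).2 - (T^[n] p).2) := by
  intro E _ T ρ lam μ κ hlam0 hlam1 hκ hμ hx hcone p q hp hpq1 hpq2 n
  have hq : ‖q.1‖ ≤ ρ := hpq1 ▸ hp
  induction n with
  | zero =>
    simp only [iterate_zero, id_eq, pow_zero, one_mul, le_refl, true_and, hpq1, sub_self,
      norm_zero]
    exact mul_nonneg hκ (sub_nonneg.2 hpq2)
  | succ n ih =>
    have hpn : ‖(T^[n] p).1‖ ≤ ρ := (iterate_fst_le hlam0 hlam1 hx hp n).trans hp
    have hqn : ‖(T^[n] q).1‖ ≤ ρ := (iterate_fst_le hlam0 hlam1 hx hq n).trans hq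
    have hord : (T^[n] p).2 ≤ (T^[n] q).2 := by
      have := ih.1
      have h0 : 0 ≤ μ ^ n * (q.2 - p.2) := mul_nonneg (pow_nonneg hμ n) (sub_nonneg.2 hpq2)
      linarith
    have hstep := hcone _ _ hpn hqn hord ih.2
    rw [iterate_succ_apply', iterate_succ_apply']
    refine ⟨?_, hstep.2⟩
    calc μ ^ (n + 1) * (q.2 - p.2) = μ * (μ ^ n * (q.2 - p.2)) := by ring
      _ ≤ μ * ((T^[n] q).2 - (T^[n] p).2) := by gcongr; exact ih.1
      _ ≤ (T (T^[n] q)).2 - (T (T^[n] p)).2 := hstep.1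

/-- An orbit of the tube that is never strictly above and never strictly below the noise level
stays within the norm of its initial `x`-component. [folklore] -/
theorem iterate_norm_le_of_noise {T : E × ℝ → E × ℝ} {ρ lam : ℝ} (hlam0 : 0 ≤ lam)
    (hlam1 : lam ≤ 1) (hx : ∀ p : E × ℝ, ‖p.1‖ ≤ ρ → ‖(T p).1‖ ≤ lam * ‖p.1‖)
    {p : E × ℝ} (hp : ‖p.1‖ ≤ ρ) (hup : ∀ n, (T^[n] p).2 ≤ ‖(T^[n] p).1‖)
    (hdown : ∀ n, -‖(T^[n] p).1‖ ≤ (T^[n] p).2) (n : ℕ) : ‖T^[n] p‖ ≤ ‖p.1‖ := by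
  rw [Prod.norm_def, max_le_iff]
  refine ⟨iterate_fst_le hlam0 hlam1 hx hp n, ?_⟩
  rw [Real.norm_eq_abs, abs_le]
  exact ⟨by linarith [hdown n, iterate_fst_le hlam0 hlam1 hx hp n],
    (hup n).trans (iterate_fst_le hlam0 hlam1 hx hp n)⟩

/-! ### The mirror map -/

omit [NormedAddCommGroup E] in
/-- Iterates of the mirror map `(x, t) ↦ ((T (x, -t)).1, -(T (x, -t)).2)` are the mirrored
iterates. [folklore] -/
theorem iterate_mirror {E : Type*} (T : E × ℝ → E × ℝ) (n : ℕ) (p : E × ℝ) :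
    (fun q : E × ℝ ↦ ((T (q.1, -q.2)).1, -(T (q.1, -q.2)).2))^[n] p =
      ((T^[n] (p.1, -p.2)).1, -(T^[n] (p.1, -p.2)).2) := by
  induction n generalizing p with
  | zero => simp
  | succ n ih =>
    rw [iterate_succ_apply, ih, iterate_succ_apply]
    simp

/-- The mirror map satisfies (H1). [folklore] -/
theorem mirror_hx {T : E × ℝ → E × ℝ} {ρ lam : ℝ}
    (hx : ∀ p : E × ℝ, ‖p.1‖ ≤ ρ → ‖(T p).1‖ ≤ lam * ‖p.1‖) :
    ∀ p : E × ℝ, ‖p.1‖ ≤ ρ →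
      ‖((fun q : E × ℝ ↦ ((T (q.1, -q.2)).1, -(T (q.1, -q.2)).2)) p).1‖ ≤ lam * ‖p.1‖ :=
  fun p hp ↦ hx (p.1, -p.2) hp

/-- The mirror map satisfies (H2). [folklore] -/
theorem mirror_hcone {T : E × ℝ → E × ℝ} {ρ μ κ : ℝ}
    (hcone : ∀ p q : E × ℝ, ‖p.1‖ ≤ ρ → ‖q.1‖ ≤ ρ → p.2 ≤ q.2 → ‖q.1 - p.1‖ ≤ κ * (q.2 - p.2) →
      μ * (q.2 - p.2) ≤ (T q).2 - (T p).2 ∧ ‖(T q).1 - (T p).1‖ ≤ κ * ((T q).2 - (T p).2)) :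
    ∀ p q : E × ℝ, ‖p.1‖ ≤ ρ → ‖q.1‖ ≤ ρ → p.2 ≤ q.2 → ‖q.1 - p.1‖ ≤ κ * (q.2 - p.2) →
      μ * (q.2 - p.2) ≤ ((fun q : E × ℝ ↦ ((T (q.1, -q.2)).1, -(T (q.1, -q.2)).2)) q).2 -
          ((fun q : E × ℝ ↦ ((T (q.1, -q.2)).1, -(T (q.1, -q.2)).2)) p).2 ∧
        ‖((fun q : E × ℝ ↦ ((T (q.1, -q.2)).1, -(T (q.1, -q.2)).2)) q).1 -
            ((fun q : E × ℝ ↦ ((T (q.1, -q.2)).1, -(T (q.1, -q.2)).2)) p).1‖ ≤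
          κ * (((fun q : E × ℝ ↦ ((T (q.1, -q.2)).1, -(T (q.1, -q.2)).2)) q).2 -
            ((fun q : E × ℝ ↦ ((T (q.1, -q.2)).1, -(T (q.1, -q.2)).2)) p).2) := by
  intro p q hp hq hpq hc
  have hord : ((q.1, -q.2) : E × ℝ).2 ≤ ((p.1, -p.2) : E × ℝ).2 := by simp only; linarith
  have hc' : ‖((p.1, -p.2) : E × ℝ).1 - ((q.1, -q.2) : E × ℝ).1‖ ≤
      κ * (((p.1, -p.2) : E × ℝ).2 - ((q.1, -q.2) : E × ℝ).2) := by
    simp only [norm_sub_rev p.1 q.1]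
    convert hc using 2
    ring
  have h := hcone (q.1, -q.2) (p.1, -p.2) hq hp hord hc'
  simp only at h ⊢
  constructor
  · linarith [h.1]
  · rw [norm_sub_rev]
    linarith [h.2]

/-- The mirror map satisfies (H3). [folklore] -/
theorem mirror_haxis {T : E × ℝ → E × ℝ} {ρ δ : ℝ}
    (haxis : ∀ x : E, ‖x‖ ≤ ρ → |(T (x, 0)).2| ≤ δ * ‖x‖) :
    ∀ x : E, ‖x‖ ≤ ρ →
      |((fun q : E × ℝ ↦ ((T (q.1, -q.2)).1, -(T (q.1, -q.2)).2)) (x, 0)).2| ≤ δ * ‖x‖ := by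
  intro x hx
  simpa using haxis x hx

/-- The mirror map is continuous if `T` is. [folklore] -/
theorem continuous_mirror {T : E × ℝ → E × ℝ} (hT : Continuous T) :
    Continuous fun q : E × ℝ ↦ ((T (q.1, -q.2)).1, -(T (q.1, -q.2)).2) := by
  fun_prop


/-- Iterated descent strictly below the noise level (the mirror image of `iterate_above`).
[folklore] -/
theorem iterate_below {T : E × ℝ → E × ℝ} {ρ lam μ κ δ : ℝ} (hlam0 : 0 ≤ lam) (hlam1 : lam ≤ 1)
    (hκ : 0 ≤ κ) (hδ : 0 ≤ δ) (hlamμ : lam < μ - δ)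
    (hx : ∀ p : E × ℝ, ‖p.1‖ ≤ ρ → ‖(T p).1‖ ≤ lam * ‖p.1‖)
    (hcone : ∀ p q : E × ℝ, ‖p.1‖ ≤ ρ → ‖q.1‖ ≤ ρ → p.2 ≤ q.2 → ‖q.1 - p.1‖ ≤ κ * (q.2 - p.2) →
      μ * (q.2 - p.2) ≤ (T q).2 - (T p).2 ∧ ‖(T q).1 - (T p).1‖ ≤ κ * ((T q).2 - (T p).2))
    (haxis : ∀ x : E, ‖x‖ ≤ ρ → |(T (x, 0)).2| ≤ δ * ‖x‖)
    {p : E × ℝ} (hp : ‖p.1‖ ≤ ρ) (hbelow : p.2 < -‖p.1‖) (n : ℕ) :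
    (T^[n] p).2 ≤ (μ - δ) ^ n * p.2 ∧ (T^[n] p).2 < -‖(T^[n] p).1‖ := by
  have h := iterate_above (T := fun q : E × ℝ ↦ ((T (q.1, -q.2)).1, -(T (q.1, -q.2)).2))
    (p := (p.1, -p.2)) hlam0 hlam1 hκ hδ hlamμ (mirror_hx hx) (mirror_hcone hcone)
    (mirror_haxis haxis) hp (by simp only; linarith) n
  rw [iterate_mirror] at h
  simp only [neg_neg, Prod.mk.eta] at h
  constructor
  · linarith [h.1]
  · linarith [h.2]

end Summit.FinalStateConjecture.FinalStateConjecture.Theorems.LaminatedThreshold.Comb
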